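import Literature.Probability.LatticeModels.MedialInterface
import HarnessLib

/-!
# `LagHandOff` (stmt-CriticalPhenomena-10268), line `crosscut-dictionary`, STUB 5
# `stub_discretisable`: the combinatorial obstruction to admissibility

Negative lemma of the standing adversary (refuter `cdisprove`, cycles 3–4) for the prover of
`stub_discretisable : ∀ D, ∃ E, ZdDiscretisationFamily D E` (every Dobrushin domain carries
admissible G02 data at all small meshes).  Admissibility (`DiscreteDobrushin.IsZdAdmissible`:
disjoint discrete arcs covering `zdBoundary`, EXACTLY TWO `A`–`B` edges, …) makes `{e_a, e_b}` a
2-edge cut of the boundary graph `G_∂` (sites of `zdBoundary`, edges of `Ω_δ`) between the two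
discrete arcs:

* `exists_mem_zdABEdges_of_chain` — discrete intermediate value theorem: if the arcs are
  disjoint and cover the discrete boundary, every boundary chain (consecutive sites
  `Ω_δ`-adjacent, inner sites in `zdBoundary`) from an `A`-site to a `B`-site traverses an
  `A`–`B` edge;
* `not_isZdAdmissible_of_three_chains` — hence THREE pairwise edge-disjoint boundary chains from
  `A`-sites to `B`-sites kill admissibility; `two_of_three_chains_share_an_edge` — the same read
  positively under admissibility;
* `not_isZdAdmissible_of_ab_edge_two_inner_faces` — an `A`–`B` edge bordering two distinct inner
  faces (an interior rung of a ladder) kills admissibility (no counting needed).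

How a counterexample to STUB 5 would have to look (none is claimed; the cycle-3 analysis in
`Cruxes/LagHandOff/Disproof.lean`, docstring of `Targets.not_isZdAdmissible_of_three_chains`,
finds every mechanism — cusps, combs, parallel exterior filaments, nested bays — defeated by the
discretiser's freedom: dust in the Hausdorff clauses, an adaptive chord-free cut position within
`o(1)` of `a` and `b`): a Jordan boundary rough at every scale near `a` forcing, for every
admissible-looking assignment, a third edge-disjoint `A`–`B` boundary chain.
-/

namespace Summit.CriticalPhenomena.CardyFormulaZ2.Theorems.LagHandOff.Negative

open Literature.Probability.LatticeModels

/-- **Discrete intermediate value theorem on the boundary.**  If the two discrete arcs are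
disjoint and cover the discrete boundary, every boundary chain `x :: l` (consecutive sites
`Ω_δ`-adjacent, the sites of `l` in `zdBoundary`) starting on the arc of `A` and ending on the
arc of `B` traverses an `A`–`B` edge. [folklore] -/
theorem exists_mem_zdABEdges_of_chain (E : DiscreteDobrushin)
    (hcover : E.zdBoundary ⊆ E.zdArcA ∪ E.zdArcB) (hdisj : Disjoint E.zdArcA E.zdArcB) :
    ∀ (l : List (Site 2)) (x : Site 2), x ∈ E.zdArcA → (∀ y ∈ l, y ∈ E.zdBoundary) →
      (∀ p ∈ (x :: l).zip l, (discreteDomainGraph E.Ω E.δ).Adj p.1 p.2) →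
      (x :: l).getLast (List.cons_ne_nil x l) ∈ E.zdArcB →
      ∃ p ∈ (x :: l).zip l, s(p.1, p.2) ∈ E.zdABEdges
  | [], x, hA, _, _, hB => by
    have hB' : x ∈ E.zdArcB := by simpa using hB
    exact (Set.disjoint_left.1 hdisj hA hB').elim
  | y :: l, x, hA, hbd, hadj, hB => by
    have hxy : (discreteDomainGraph E.Ω E.δ).Adj x y := hadj (x, y) (by simp)
    by_cases hy : y ∈ E.zdArcB
    · refine ⟨(x, y), by simp, ?_⟩
      rw [DiscreteDobrushin.mem_zdABEdges_iff]
      exact ⟨(SimpleGraph.mem_edgeSet _).2 hxy, ⟨x, by simp, hA⟩, ⟨y, by simp, hy⟩⟩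
    · have hyA : y ∈ E.zdArcA := (hcover (hbd y (by simp))).resolve_right hy
      have hB' : (y :: l).getLast (List.cons_ne_nil y l) ∈ E.zdArcB := by
        have := hB
        rwa [List.getLast_cons (List.cons_ne_nil y l)] at this
      obtain ⟨p, hp, hpAB⟩ := exists_mem_zdABEdges_of_chain E hcover hdisj l y hyA
        (fun z hz => hbd z (by simp [hz]))
        (fun p hp => hadj p (by
          rw [List.zip_cons_cons]
          exact List.mem_cons_of_mem _ hp)) hB'
      refine ⟨p, ?_, hpAB⟩
      rw [List.zip_cons_cons]
      exact List.mem_cons_of_mem _ hp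

/-- **OBSTRUCTION TO ADMISSIBILITY (three chains).**  Three boundary chains from `A`-sites to
`B`-sites whose edge lists are pairwise disjoint are impossible for admissible data: each
traverses an `A`–`B` edge (`exists_mem_zdABEdges_of_chain`), the three edges are distinct, but
admissible data have exactly two `A`–`B` edges. [folklore] -/
theorem not_isZdAdmissible_of_three_chains (E : DiscreteDobrushin)
    {x₁ x₂ x₃ : Site 2} {l₁ l₂ l₃ : List (Site 2)}
    (hA₁ : x₁ ∈ E.zdArcA) (hbd₁ : ∀ y ∈ l₁, y ∈ E.zdBoundary)
    (hadj₁ : ∀ p ∈ (x₁ :: l₁).zip l₁, (discreteDomainGraph E.Ω E.δ).Adj p.1 p.2)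
    (hB₁ : (x₁ :: l₁).getLast (List.cons_ne_nil x₁ l₁) ∈ E.zdArcB)
    (hA₂ : x₂ ∈ E.zdArcA) (hbd₂ : ∀ y ∈ l₂, y ∈ E.zdBoundary)
    (hadj₂ : ∀ p ∈ (x₂ :: l₂).zip l₂, (discreteDomainGraph E.Ω E.δ).Adj p.1 p.2)
    (hB₂ : (x₂ :: l₂).getLast (List.cons_ne_nil x₂ l₂) ∈ E.zdArcB)
    (hA₃ : x₃ ∈ E.zdArcA) (hbd₃ : ∀ y ∈ l₃, y ∈ E.zdBoundary)
    (hadj₃ : ∀ p ∈ (x₃ :: l₃).zip l₃, (discreteDomainGraph E.Ω E.δ).Adj p.1 p.2)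
    (hB₃ : (x₃ :: l₃).getLast (List.cons_ne_nil x₃ l₃) ∈ E.zdArcB)
    (h₁₂ : (((x₁ :: l₁).zip l₁).map fun p => s(p.1, p.2)).Disjoint
      (((x₂ :: l₂).zip l₂).map fun p => s(p.1, p.2)))
    (h₁₃ : (((x₁ :: l₁).zip l₁).map fun p => s(p.1, p.2)).Disjoint
      (((x₃ :: l₃).zip l₃).map fun p => s(p.1, p.2)))
    (h₂₃ : (((x₂ :: l₂).zip l₂).map fun p => s(p.1, p.2)).Disjoint
      (((x₃ :: l₃).zip l₃).map fun p => s(p.1, p.2))) :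
    ¬ E.IsZdAdmissible := by
  intro hadm
  have hcover := hadm.zdBoundary_subset
  have hdisj := hadm.disjoint
  obtain ⟨p₁, hp₁, hab₁⟩ := exists_mem_zdABEdges_of_chain E hcover hdisj l₁ x₁ hA₁ hbd₁ hadj₁ hB₁
  obtain ⟨p₂, hp₂, hab₂⟩ := exists_mem_zdABEdges_of_chain E hcover hdisj l₂ x₂ hA₂ hbd₂ hadj₂ hB₂
  obtain ⟨p₃, hp₃, hab₃⟩ := exists_mem_zdABEdges_of_chain E hcover hdisj l₃ x₃ hA₃ hbd₃ hadj₃ hB₃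
  have he₁ : s(p₁.1, p₁.2) ∈ ((x₁ :: l₁).zip l₁).map fun p => s(p.1, p.2) :=
    List.mem_map.2 ⟨p₁, hp₁, rfl⟩
  have he₂ : s(p₂.1, p₂.2) ∈ ((x₂ :: l₂).zip l₂).map fun p => s(p.1, p.2) :=
    List.mem_map.2 ⟨p₂, hp₂, rfl⟩
  have he₃ : s(p₃.1, p₃.2) ∈ ((x₃ :: l₃).zip l₃).map fun p => s(p.1, p.2) :=
    List.mem_map.2 ⟨p₃, hp₃, rfl⟩
  have hne₁₂ : s(p₁.1, p₁.2) ≠ s(p₂.1, p₂.2) := fun h => h₁₂ he₁ (h ▸ he₂)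
  have hne₁₃ : s(p₁.1, p₁.2) ≠ s(p₃.1, p₃.2) := fun h => h₁₃ he₁ (h ▸ he₃)
  have hne₂₃ : s(p₂.1, p₂.2) ≠ s(p₃.1, p₃.2) := fun h => h₂₃ he₂ (h ▸ he₃)
  obtain ⟨p, q, -, hpq⟩ := Set.ncard_eq_two.1 hadm.ncard_zdABEdges_eq_two
  rw [hpq] at hab₁ hab₂ hab₃
  simp only [Set.mem_insert_iff, Set.mem_singleton_iff] at hab₁ hab₂ hab₃
  rcases hab₁ with h1 | h1 <;> rcases hab₂ with h2 | h2 <;> rcases hab₃ with h3 | h3 <;>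
    simp_all

/-- The obstruction read positively: under admissibility, among any three boundary chains from
the arc of `A` to the arc of `B` two share an edge (the boundary graph between the arcs has
edge-connectivity at most `2`, realised by `{e_a, e_b}`). [folklore] -/
theorem two_of_three_chains_share_an_edge {E : DiscreteDobrushin} (hadm : E.IsZdAdmissible)
    {x₁ x₂ x₃ : Site 2} {l₁ l₂ l₃ : List (Site 2)}
    (hA₁ : x₁ ∈ E.zdArcA) (hbd₁ : ∀ y ∈ l₁, y ∈ E.zdBoundary)
    (hadj₁ : ∀ p ∈ (x₁ :: l₁).zip l₁, (discreteDomainGraph E.Ω E.δ).Adj p.1 p.2)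
    (hB₁ : (x₁ :: l₁).getLast (List.cons_ne_nil x₁ l₁) ∈ E.zdArcB)
    (hA₂ : x₂ ∈ E.zdArcA) (hbd₂ : ∀ y ∈ l₂, y ∈ E.zdBoundary)
    (hadj₂ : ∀ p ∈ (x₂ :: l₂).zip l₂, (discreteDomainGraph E.Ω E.δ).Adj p.1 p.2)
    (hB₂ : (x₂ :: l₂).getLast (List.cons_ne_nil x₂ l₂) ∈ E.zdArcB)
    (hA₃ : x₃ ∈ E.zdArcA) (hbd₃ : ∀ y ∈ l₃, y ∈ E.zdBoundary)
    (hadj₃ : ∀ p ∈ (x₃ :: l₃).zip l₃, (discreteDomainGraph E.Ω E.δ).Adj p.1 p.2)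
    (hB₃ : (x₃ :: l₃).getLast (List.cons_ne_nil x₃ l₃) ∈ E.zdArcB) :
    ¬ ((((x₁ :: l₁).zip l₁).map fun p => s(p.1, p.2)).Disjoint
          (((x₂ :: l₂).zip l₂).map fun p => s(p.1, p.2)) ∧
       (((x₁ :: l₁).zip l₁).map fun p => s(p.1, p.2)).Disjoint
          (((x₃ :: l₃).zip l₃).map fun p => s(p.1, p.2)) ∧
       (((x₂ :: l₂).zip l₂).map fun p => s(p.1, p.2)).Disjoint
          (((x₃ :: l₃).zip l₃).map fun p => s(p.1, p.2))) :=
  fun h => not_isZdAdmissible_of_three_chains E hA₁ hbd₁ hadj₁ hB₁ hA₂ hbd₂ hadj₂ hB₂ hA₃ hbd₃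
    hadj₃ hB₃ h.1 h.2.1 h.2.2 hadm

/-- **OBSTRUCTION TO ADMISSIBILITY (two inner faces).**  An `A`–`B` edge of admissible data
borders exactly one inner face; so an `A`–`B` edge bordering TWO distinct inner faces (an interior
rung of a ladder-shaped neck) kills admissibility. [folklore] -/
theorem not_isZdAdmissible_of_ab_edge_two_inner_faces (E : DiscreteDobrushin)
    {e : Sym2 (Site 2)} (he : e ∈ E.zdABEdges) {f f' : Site 2} (hff' : f ≠ f')
    (hf : E.IsInnerFace f ∧ ∀ x ∈ e, IsCorner x f)
    (hf' : E.IsInnerFace f' ∧ ∀ x ∈ e, IsCorner x f') : ¬ E.IsZdAdmissible := fun hadm =>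
  hff' ((hadm.zdABEdges_inner e he).unique hf hf')

end Summit.CriticalPhenomena.CardyFormulaZ2.Theorems.LagHandOff.Negative
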